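import Mathlib
import HarnessLib
import Summits.Langlands.Langlands.Theses.EisensteinMonodromy
import Literature.NumberTheory.GaloisRepresentations.WeilDeligneGeneric
import Literature.NumberTheory.GaloisRepresentations.WeilDeligneDominance

/-!
# Birth skeleton (BC3) for crux stmt-Langlands-2372
`Summit.Langlands.Langlands.Theses.EisensteinMonodromy.EisensteinEnvelopeGeneric` — line `birth`

Route `route-Langlands-EisensteinMonodromy` (rank-2 crux; "card items C1+C2 pushed to the Galois side;
Varma's Prop. 9.1 with `≺` upgraded to equality").  The crux asserts, for `K` CM, `π` regular algebraic
cuspidal on `GL_n(𝔸_K)`, `p`, `ι`: an envelope family `R_N : Γ_K → GL_{2n}(ℚ̄_p)` (`N ≥ N₀`), semisimple,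
with the Harris–Lan–Taylor–Thorne Cor. 6.27 Frobenius characteristic polynomials
`arithFrobPolyOfSatake ι q_v n α · ∏_{b ∈ B_v}(X − b q_v^{−2N})` at all but finitely many `v`, whose
Weil–Deligne representation at every `v ∤ p` is GENERIC (Allen 2016 Def. 1.1.2 = the tree's
`WeilDeligneRep.IsGeneric`, `isGeneric_iff` is `Iff.rfl`) for `N ≫_v 0`.

The skeleton cuts the crux along the two places where its content actually lives:

* `stub_dominantEnvelope` — **the envelope, with the mechanism's output at the BAD places.**  There are
  `N₀, R, B` and a FINITE exceptional set `T` of places such that (1) `R_N` is semisimple, (2) `B_v` has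
  `n` non-zero elements, (3) at `v ∉ T` with Satake parameter `α` the Cor. 6.27 identity holds (HLTT
  Cor. 6.27 / Varma Prop. 7.1, tree facts `corollary627_splitOrUnramified`, `prop71_twoN`), (4) at such
  GOOD places the roots of the envelope polynomial are pairwise `q_v`-UNLINKED (`x ≠ q_v y`) for
  `N ≫_v 0` — Jacquet–Shalika's strict bound `q_v^{-1/2} < |α_j| < q_v^{1/2}` for the generic unitary
  `π_v`, `π_{ᶜv}` (tree fact `JacquetShalika1981_norm_lt_sqrt_of_isGeneric`) plus the weight separation
  `q_v^{−2N}` between the two blocks (route header, observation (i)) — and (5) at the finitely many BAD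
  places `v ∤ p` (`v ∈ T` or no Satake parameter) and `N ≫_v 0`, the Weil–Deligne representation `W` of
  `R_N|_{Γ_{K_v}}` has a Frobenius-semisimple GENERIC trace-twin `S` with `S ≺_I W` and `W ≺_I S`
  (Varma's inertial dominance order `WeilDeligneRep.PrecI`): Varma's Thm 2 / Prop. 9.1 give `W ≺ S`
  for the automorphic generic `S = ı⁻¹rec(π_v|det|^{(1-n)/2}) ⊕ (…)ε^{1-2n-2N}`; the REVERSE inequality
  `S ≺_I W` ("`≺` is an equality") is exactly what the co-Whittaker property of the Eisenstein-localised
  `U(n,n)` Hecke module (informal cruxes BoundaryCoWhittaker / GenericFibreInducedType; Emerton–Helm,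
  Helm–Moss: the co-Whittaker specialisation at `x_E` is the generic representation with the interpolated
  supercuspidal support) would deliver on the Galois side.  This stub carries the crux's open content and
  its `why it might fail` verbatim (non-co-Whittaker Eisenstein fibre ⇒ `S ≺_I W` fails, Varma's `≺`
  strict).  Size XL / open-problem.
* `stub_unramifiedGeneric` — **good places are free.**  A framed `ρ : Γ_K → GL_m(ℚ̄_p)` unramified at
  `v ∤ p` whose arithmetic-Frobenius characteristic polynomial has pairwise `q_v`-unlinked roots admits a
  Weil–Deligne representation at `v` (namely `(ρ|_{W_{K_v}}, N = 0)`, `IsWeilDeligneOfLadic.of_N_eq_zero`)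
  which is generic: a morphism `f : r → r(1)` solves the Sylvester equation `f ρ(Φ) = q_v ρ(Φ) f`, whose
  only solution is `0` when `Spec ρ(Φ) ∩ q_v Spec ρ(Φ) = ∅`.  Needs the local–global dictionary at `v`
  (`isUnramifiedAt_iff_toLocal`; local arithmetic Frobenius ↦ `IsArithFrobAt`).  Size M, provable now.
* `stub_isGeneric_of_generic_precI` — **dominating a generic trace-twin forces genericity** (pure local
  algebra over an algebraically closed field of characteristic `0`).  If `S` is Frobenius-semisimple and
  generic, `tr S(w) = tr W(w)` for all `w ∈ W_F`, and `S ≺_I W`, then `W` is generic: pass to `W^{F-ss}`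
  (tree: `exists_isFrobSemisimplificationOf`, `IsFrobSemisimplificationOf.precI_iff_right`), identify
  `S.ρ ≅ W^{F-ss}.ρ` by Brauer–Nesbitt, and use that for Frobenius-semisimple `r` the generic monodromy
  operators are exactly those all of whose chain-composites `M_{s,k} → M_{s,k+j}` have maximal rank
  (generic ⟺ no two segments linked, Allen Lemma 1.1.3 / Zelevinsky; A'Campo–Hevesi–Thorne–Whitmore
  Prop. 6.0.5: the generic orbit is the unique open = `≺`-maximal one), while `rk N^j|_{V[θ]}` is a
  positive combination of these composite ranks — so `≺_I`-dominating a generic `N` forces every composite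
  rank to be maximal; finally genericity ascends from `W^{F-ss}` to `W` (a morphism `W → W(1)` twisted-
  commutes with the semisimple parts).  Size L, provable now.
* `EisensteinEnvelopeGeneric_of` — **the composition, kernel-checked**: cofinite clause from `T` finite;
  at a good place `stub_unramifiedGeneric` on `R_N` with the clause-(4) threshold; at a bad place
  `stub_isGeneric_of_generic_precI` on the pair `(W, S)` of clause (5).  Concludes the route decl BY NAME.

Honest reading of the cut.  The envelope is pinned only existentially (route review #3, S1: `B_v` is
unconstrained), so the bad-place dominance cannot be a universal statement over abstract families with
properties (1)–(4) — such a statement is false (take `R_N = r ⊕ C₀ ε_p^{−2N}` with `C₀` semisimple,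
`q`-unlinked Frobenius eigenvalues at the good places but non-generic `WD(C₀|_{K_v})` at a bad `v`); hence
the open content sits in ONE existential stub, stated in the inequality format the automorphic method
outputs, and the two local theorems are split off.  `stub_dominantEnvelope` is implied by the crux modulo
the two local stubs' converses (all true), so the skeleton is sound: crux true ⇒ all stubs true.

Disproof used: none on file for this crux (`ledger crux ls stmt-Langlands-2372`: no workfiles, no
`Disproof.lean`, no `Negative/` lemmas, 2026-08-17).

Shape (for `ledger skeleton check`): stubs `theorem stub_<name> : <signature> := by sorry` over tree
declarations only; `_Goal.stub_<name> : Prop := type_of% @stub_<name>`; the composition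
`EisensteinEnvelopeGeneric_of (h₁ : _Goal.stub_dominantEnvelope) (h₂ : _Goal.stub_unramifiedGeneric)
(h₃ : _Goal.stub_isGeneric_of_generic_precI) : EisensteinEnvelopeGeneric` is proved without `sorry`.
-/

set_option linter.dupNamespace false
set_option linter.unusedVariables false

noncomputable section

namespace Summit.Langlands.Langlands.Cruxes.EisensteinEnvelopeGeneric.Birth

open Summit.Langlands.Langlands.Theses.EisensteinMonodromy
open Literature.NumberTheory.Automorphic Literature.NumberTheory.GaloisRepresentations
open NumberField IsDedekindDomain Polynomial Filter
open scoped NumberField Polynomial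

/-! ## 1. The three stubs -/

/-- **STUB 1 — the dominant Eisenstein envelope (HLTT Cor. 6.27 + Jacquet–Shalika at the good places;
Varma's `≺` upgraded to an equality at the bad places).**  For `K` CM, `π` regular algebraic cuspidal on
`GL_n(𝔸_K)`, `p`, `ι : ℚ̄_p ≃ ℂ`: there are `N₀`, a family `R : ℕ → (Γ_K →ₜ* GL_{2n}(ℚ̄_p))`, multisets
`B_v` and a FINITE set `T` of finite places such that
(1) `R_N` is semisimple for `N ≥ N₀`;
(2) `B_v` has `n` elements, all non-zero;
(3) for `v ∉ T` and every Satake parameter `α` of `π` at `v`, for `N ≥ N₀`: `R_N` is unramified at `v`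
    with arithmetic-Frobenius characteristic polynomial
    `arithFrobPolyOfSatake ι q_v n α · ∏_{b ∈ B_v} (X − b q_v^{−2N})` (HLTT Cor. 6.27, p. 225);
(4) for such `v, α` and `N ≫_v 0` the roots of that polynomial are pairwise `q_v`-unlinked:
    `x ≠ q_v · y` (Jacquet–Shalika (5.1.3) two-sided for `π_v` and `π_{ᶜv}`, and the weight gap
    `q_v^{−2N}` between the two factors);
(5) for every BAD place `v ∤ p` — `v ∈ T`, or `π` has no Satake parameter at `v` — and `N ≫_v 0`
    there are a Weil–Deligne representation `W` attached to `R_N|_{Γ_{K_v}}` (Grothendieck–Deligne,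
    `IsWeilDeligneOfLadic`) and a Frobenius-semisimple GENERIC `S` on the same space with the same
    traces, `S ≺_I W` and `W ≺_I S` (`WeilDeligneRep.PrecI`, Varma Def. 8.3).
Why plausibly true: (1)–(3) are HLTT Cor. 6.27 / Varma Prop. 7.1 (+ solvable base change to reach a
general CM `K`); (4) is the strict Jacquet–Shalika bound; in (5) `W ≺ S` is Varma's Prop. 9.1 and
`S ≺_I W` is the route's bet (co-Whittaker Eisenstein fibre).  Why it might fail: the crux's own —
a non-co-Whittaker Eisenstein-localised Hecke module at `v` makes Varma's `≺` strict.  Size XL (open).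
[cite: HarrisLanTaylorThorneRMS2016, Cor. 6.27 (p. 225), Prop. 7.12, Thm. 7.13]
[cite: VarmaFMS2024, Thm. 2, Def. 8.3, Prop. 9.1] [cite: JacquetShalikaAJM1981, Cor. (2.5), (5.1.3)]
[cite: EmertonHelm2014, Conj. 1.1.3, Def. 6.1–6.2] [cite: HelmMoss2018, §2] -/
theorem stub_dominantEnvelope :
    ∀ (K : Type) [Field K] [NumberField K], IsCMField K →
    ∀ (n : ℕ) (hcpt : isCompact_glFiniteIntegralLevel n K) (π : CuspidalAutomorphicRepData n K hcpt),
      π.1.IsRegularAlgebraic → ∀ (p : ℕ) [Fact p.Prime] (ι : PadicAlgCl p ≃+* ℂ),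
    ∃ (N₀ : ℕ) (R : ℕ → FramedGaloisRep K (PadicAlgCl p) (2 * n))
      (B : HeightOneSpectrum (𝓞 K) → Multiset (PadicAlgCl p)) (T : Set (HeightOneSpectrum (𝓞 K))),
      T.Finite ∧
      (∀ N, N₀ ≤ N → (R N).toGaloisRep.IsSemisimple) ∧
      (∀ v, Multiset.card (B v) = n ∧ (0 : PadicAlgCl p) ∉ B v) ∧
      (∀ v ∉ T, ∀ α : Multiset ℂ, π.1.HasSatakeParamAt v α → ∀ N, N₀ ≤ N →
        (R N).IsUnramifiedAt v ∧
        (R N).HasFrobCharpolyAt v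
          (arithFrobPolyOfSatake ι v.residueCard n α *
            ((B v).map fun b ↦ X - C (b * ((v.residueCard : PadicAlgCl p)⁻¹) ^ (2 * N))).prod)) ∧
      (∀ v ∉ T, ∀ α : Multiset ℂ, π.1.HasSatakeParamAt v α → ∃ N₂ : ℕ, ∀ N, N₂ ≤ N →
        ∀ x ∈ (arithFrobPolyOfSatake ι v.residueCard n α *
            ((B v).map fun b ↦ X - C (b * ((v.residueCard : PadicAlgCl p)⁻¹) ^ (2 * N))).prod).roots,
        ∀ y ∈ (arithFrobPolyOfSatake ι v.residueCard n α *
            ((B v).map fun b ↦ X - C (b * ((v.residueCard : PadicAlgCl p)⁻¹) ^ (2 * N))).prod).roots,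
          x ≠ (v.residueCard : PadicAlgCl p) * y) ∧
      (∀ v : HeightOneSpectrum (𝓞 K), ((p : ℕ) : 𝓞 K) ∉ v.asIdeal →
        (v ∈ T ∨ ∀ α : Multiset ℂ, ¬ π.1.HasSatakeParamAt v α) →
        ∃ N₁ : ℕ, ∀ N, N₁ ≤ N →
          ∃ W S : WeilDeligneRep (v.adicCompletion K) (PadicAlgCl p) (Fin (2 * n) → PadicAlgCl p),
            IsWeilDeligneOfLadic ((R N).toLocal v).toWeilGroupHom W ∧
            S.IsFrobSemisimple ∧ S.IsGeneric ∧
            (∀ w : WeilGroup (v.adicCompletion K),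
              LinearMap.trace (PadicAlgCl p) (Fin (2 * n) → PadicAlgCl p) (S.ρ w) =
                LinearMap.trace (PadicAlgCl p) (Fin (2 * n) → PadicAlgCl p) (W.ρ w)) ∧
            S.PrecI W ∧ W.PrecI S) := by
  sorry

/-- **STUB 2 — unramified representations with `q_v`-unlinked Frobenius eigenvalues have a generic
Weil–Deligne representation (good places are free).**  Let `ρ : Γ_K →ₜ* GL_m(ℚ̄_p)` be unramified at a
finite place `v ∤ p` of the number field `K`, with arithmetic-Frobenius characteristic polynomial `P` at
`v` whose roots are pairwise `q_v`-unlinked (`x ≠ q_v · y`; `x = y` allowed, i.e. no root is `0`).  Then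
some (hence every) Weil–Deligne representation attached to `ρ|_{Γ_{K_v}}` by the Grothendieck–Deligne
recipe is generic: `W := (ρ|_{W_{K_v}}, N = 0)` is attached (`IsWeilDeligneOfLadic.of_N_eq_zero`, any
tame character `t` non-trivial on inertia; local inertia maps into the global inertia groups above `v`,
`isUnramifiedAt_iff_toLocal`), a local arithmetic Frobenius lift `Φ` maps to an arithmetic Frobenius at
the prime above `v` cut out by `absGaloisRestrict`, so `ρ(Φ)` has characteristic polynomial `P`; a
morphism `f : W → W(1)` satisfies `f ρ(Φ) = q_v ρ(Φ) f`, a Sylvester equation with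
`Spec ρ(Φ) ∩ Spec (q_v ρ(Φ)) = ∅`, hence `f = 0`.  Size M, provable now.
[cite: TateCorvallis1979, (4.1.2)–(4.2.1)] [cite: SerreAbelianLadic1968, Ch. I §2.1]
[cite: Allen2016, Def. 1.1.2 and proof of Lemma 1.1.3] -/
theorem stub_unramifiedGeneric :
    ∀ (K : Type) [Field K] [NumberField K] (p : ℕ) [Fact p.Prime] (m : ℕ)
      (ρ : FramedGaloisRep K (PadicAlgCl p) m) (v : HeightOneSpectrum (𝓞 K)),
      ((p : ℕ) : 𝓞 K) ∉ v.asIdeal → ρ.IsUnramifiedAt v →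
    ∀ (P : Polynomial (PadicAlgCl p)), ρ.HasFrobCharpolyAt v P →
      (∀ x ∈ P.roots, ∀ y ∈ P.roots, x ≠ (v.residueCard : PadicAlgCl p) * y) →
    ∃ W : WeilDeligneRep (v.adicCompletion K) (PadicAlgCl p) (Fin m → PadicAlgCl p),
      IsWeilDeligneOfLadic (ρ.toLocal v).toWeilGroupHom W ∧ W.IsGeneric := by
  sorry

/-- **STUB 3 — `≺_I`-dominating a generic trace-twin forces genericity** (pure local algebra; `F` a
non-archimedean local field, `E` algebraically closed of characteristic `0`).  Let `W, S` be
Weil–Deligne representations of `W_F` on `E^m` with `S` Frobenius-semisimple and generic,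
`tr S(w) = tr W(w)` for all `w`, and `S ≺_I W` (Varma Def. 8.3: `S|_{I_F} ≅ W|_{I_F}` and
`rk N_S^k|_{V[θ]} ≤ rk N_W^k|_{V[θ]}` for every irreducible inertia type `θ` and every `k`).  Then `W` is
generic.  Proof sketch: replace `W` by its Frobenius-semisimplification `W'` (exists; same traces, same
`N`, same inertia action, so `S ≺_I W'`); Brauer–Nesbitt gives `S.ρ ≅ W'.ρ`; for a Frobenius-semisimple
`r = ⊕_{s,k} s‖·‖^k ⊗ M_{s,k}` a monodromy operator is a family of maps `n_{s,k} : M_{s,k} → M_{s,k+1}`,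
`(r, N)` is generic iff no two segments are linked iff every composite `n_{s,k+j-1} ∘ ⋯ ∘ n_{s,k}` has the
maximal rank `min(dim M_{s,k}, …, dim M_{s,k+j})` (the generic orbit is the unique open, `≺`-maximal one:
Allen Lemma 1.1.3; A'Campo–Hevesi–Thorne–Whitmore Prop. 6.0.5), and `rk N^j|_{V[θ]}` is a positive
combination of these composite ranks over the lines `s` with `θ ⊂ s|_{I_F}`; so the transported `N_{W'}`
has all composite ranks maximal, i.e. `W'` is generic; and a morphism `W → W(1)` twisted-commutes with
the semisimple parts `ρ(w)_{ss}`, so it is a morphism `W' → W'(1)`, i.e. `W` is generic too.  Size L,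
provable now (the converse direction `(r,N) ≺ (r,N_gen)` is AHTW Prop. 6.0.5 (3)).
[cite: VarmaFMS2024, Def. 8.3, Lemma 8.4, Prop. 8.8] [cite: Allen2016, Def. 1.1.2, Lemma 1.1.3]
[cite: AHTW2026, Prop. 6.0.5] [cite: BellaicheChenevier2009, §7.8] -/
theorem stub_isGeneric_of_generic_precI :
    ∀ (F : Type) [Field F] [ValuativeRel F] [TopologicalSpace F] [IsNonarchimedeanLocalField F]
      (E : Type) [Field E] [IsAlgClosed E] [CharZero E] (m : ℕ)
      (W S : WeilDeligneRep F E (Fin m → E)),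
      S.IsFrobSemisimple → S.IsGeneric →
      (∀ w : WeilGroup F,
        LinearMap.trace E (Fin m → E) (S.ρ w) = LinearMap.trace E (Fin m → E) (W.ρ w)) →
      S.PrecI W → W.IsGeneric := by
  sorry

/-! ## 2. The stub statements as named `Prop`s (literally their types) -/

namespace _Goal

/-- The statement of `stub_dominantEnvelope`, as a named `Prop` (literally its type). [folklore] -/
def stub_dominantEnvelope : Prop :=
  type_of% @Summit.Langlands.Langlands.Cruxes.EisensteinEnvelopeGeneric.Birth.stub_dominantEnvelope

/-- The statement of `stub_unramifiedGeneric`, as a named `Prop` (literally its type). [folklore] -/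
def stub_unramifiedGeneric : Prop :=
  type_of% @Summit.Langlands.Langlands.Cruxes.EisensteinEnvelopeGeneric.Birth.stub_unramifiedGeneric

/-- The statement of `stub_isGeneric_of_generic_precI`, as a named `Prop` (literally its type).
[folklore] -/
def stub_isGeneric_of_generic_precI : Prop :=
  type_of%
    @Summit.Langlands.Langlands.Cruxes.EisensteinEnvelopeGeneric.Birth.stub_isGeneric_of_generic_precI

end _Goal

/-! ## 3. The composition (kernel-checked, no `sorry`): the three stubs give the crux by name -/

/-- **`EisensteinEnvelopeGeneric` from the three stubs.**  Take the family of `stub_dominantEnvelope`.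
The semisimplicity and `B`-clauses are verbatim; the cofinite Cor. 6.27 clause follows from clause (3)
off the finite set `T`.  At `v ∤ p`: if `v ∉ T` and `π` has a Satake parameter `α` at `v`, then for
`N ≥ max N₀ N₂` the representation `R_N` is unramified at `v` with the envelope polynomial as Frobenius
characteristic polynomial (clause (3)) whose roots are `q_v`-unlinked (clause (4)), so
`stub_unramifiedGeneric` yields a generic Weil–Deligne representation; otherwise `v` is a bad place and
clause (5) with `stub_isGeneric_of_generic_precI` makes the Weil–Deligne representation `W` of `R_N|_{K_v}`
generic.  The genericity clause of the crux is `WeilDeligneRep.IsGeneric` unfolded (`isGeneric_iff`,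
`Iff.rfl`).  Hypotheses are, by name, the statements of the three stubs; the conclusion is the route decl
`Summit.Langlands.Langlands.Theses.EisensteinMonodromy.EisensteinEnvelopeGeneric`. [folklore] -/
theorem EisensteinEnvelopeGeneric_of (h₁ : _Goal.stub_dominantEnvelope)
    (h₂ : _Goal.stub_unramifiedGeneric) (h₃ : _Goal.stub_isGeneric_of_generic_precI) :
    Summit.Langlands.Langlands.Theses.EisensteinMonodromy.EisensteinEnvelopeGeneric := by
  -- the stub statements, as the Π-types they literally are
  have hEnv : type_of% @stub_dominantEnvelope := h₁
  have hUnr : type_of% @stub_unramifiedGeneric := h₂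
  have hDom : type_of% @stub_isGeneric_of_generic_precI := h₃
  intro K _ _ hCM n hcpt π hreg p _ ι
  obtain ⟨N₀, R, B, T, hTfin, hss, hB, hchar, hroots, hbad⟩ := hEnv K hCM n hcpt π hreg p ι
  refine ⟨N₀, R, B, hss, hB, ?_, ?_⟩
  · -- the Cor. 6.27 clause holds off the finite set `T`, hence cofinitely
    filter_upwards [Set.Finite.eventually_cofinite_notMem hTfin] with v hv
    exact hchar v hv
  · intro v hv
    -- the bad-place branch, used twice below
    have bad : (v ∈ T ∨ ∀ α : Multiset ℂ, ¬ π.1.HasSatakeParamAt v α) →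
        ∃ N₁ : ℕ, ∀ N, N₁ ≤ N →
          ∃ W : WeilDeligneRep (v.adicCompletion K) (PadicAlgCl p) (Fin (2 * n) → PadicAlgCl p),
            IsWeilDeligneOfLadic ((R N).toLocal v).toWeilGroupHom W ∧ W.IsGeneric := by
      intro hb
      obtain ⟨N₁, hN₁⟩ := hbad v hv hb
      refine ⟨N₁, fun N hN => ?_⟩
      obtain ⟨W, S, hW, hSss, hSgen, htr, hprec, _hprec'⟩ := hN₁ N hN
      exact ⟨W, hW, hDom (v.adicCompletion K) (PadicAlgCl p) (2 * n) W S hSss hSgen htr hprec⟩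
    by_cases hvT : v ∈ T
    · obtain ⟨N₁, hN₁⟩ := bad (Or.inl hvT)
      refine ⟨N₁, fun N hN => ?_⟩
      obtain ⟨W, hW, hgen⟩ := hN₁ N hN
      exact ⟨W, hW, hgen⟩
    · by_cases hα : ∃ α : Multiset ℂ, π.1.HasSatakeParamAt v α
      · -- good place: unramified with `q_v`-unlinked Frobenius eigenvalues for `N ≫ 0`
        obtain ⟨α, hα⟩ := hα
        obtain ⟨N₂, hN₂⟩ := hroots v hvT α hα
        refine ⟨max N₀ N₂, fun N hN => ?_⟩
        have hN₀ : N₀ ≤ N := le_trans (le_max_left _ _) hN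
        have hN₂' : N₂ ≤ N := le_trans (le_max_right _ _) hN
        obtain ⟨hunr, hchp⟩ := hchar v hvT α hα N hN₀
        obtain ⟨W, hW, hgen⟩ := hUnr K p (2 * n) (R N) v hv hunr _ hchp (hN₂ N hN₂')
        exact ⟨W, hW, hgen⟩
      · simp only [not_exists] at hα
        obtain ⟨N₁, hN₁⟩ := bad (Or.inr hα)
        refine ⟨N₁, fun N hN => ?_⟩
        obtain ⟨W, hW, hgen⟩ := hN₁ N hN
        exact ⟨W, hW, hgen⟩

/-- By-name sanity check (an `example`, not a declaration of the file): the three stubs feed the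
composition as they stand. -/
example : Summit.Langlands.Langlands.Theses.EisensteinMonodromy.EisensteinEnvelopeGeneric :=
  EisensteinEnvelopeGeneric_of stub_dominantEnvelope stub_unramifiedGeneric
    stub_isGeneric_of_generic_precI

end Summit.Langlands.Langlands.Cruxes.EisensteinEnvelopeGeneric.Birth

end
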